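import Summits.MatrixMultiplication.OmegaCensus.SmallFormats.GF2OrbitSweepLPSplit
import Summits.MatrixMultiplication.OmegaCensus.SmallFormats.GF2FastSandwich
import Summits.MatrixMultiplication.OmegaCensus.SmallFormats.GF2ResidualFunctional
import Summits.Ventures.MM22.Rank333.GF2CertTransport
import HarnessLib

/-!
# MM22 venture, Route D3-STRETCH — assembly lemmas for the `⟨3,3,3⟩/𝔽₂` LP certificate chain

HONEST FRAMING (cell `pub-mm22`, seat p3). Generic glue, PROVED (0 sorry); no bound is claimed here. For the extended
checker `GF2OrbitSweepLP.lean` (LIT-2 g3; steps `old | lookT | lp | dfsLP`, sweep `sweepX`): (1) `okXH` / `sweepXH` —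
the sweep with orbit bounds allowed as HYPOTHESES (as `GF2CertTransport.sweepJ` did for the basic checker), so that a
chain can land while some orbit certificates are still pending and be discharged later; (2) `orbitCheckX_of_one` /
`ok_lp` / `orbitCheckX_of_two` / `stepSideX_lp` / `stepSideX_dfsLP` — an orbit with one or two steps (in particular a single LP leaf) passes its check given the named Boolean facts
(candidate cover, the two lookup tables — validated by the FAST pull-back checks of `GF2FastSandwich.lean` —, the
LP-leaf test), so that data files never evaluate the slow enumerating sandwich checks; (3) `cert_of_sweepXH` — reading
off `Cert` at any orbit of the list.
-/

namespace Summit.Ventures.MM22.GF2Cert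

open Module Matrix Literature.Computability.AlgebraicComplexity
open Summit.MatrixMultiplication.OmegaCensus.GF2RankLB

variable (l n : ℕ)

/-- Extended orbit check with hypotheses: own steps, or a hypothesis bound. -/
def okXH (os : List OrbitX) (hyps : List (ℕ × ℕ)) (i : ℕ) : Bool :=
  orbitCheckX l n os i || decide (bnd (coreOf os) i ≤ hypB hyps i)

variable {l n}

/-- **The extended sweep with hypotheses.** -/
theorem sweepXH (os : List OrbitX) (hyps : List (ℕ × ℕ))
    (hall : ∀ i < os.length, okXH l n os hyps i = true)
    (hob : ∀ i < os.length, ObligsX l n os i)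
    (hh : ∀ e ∈ hyps, Cert l l n (kOf (coreOf os) e.1) e.2) :
    ∀ i < os.length, Cert l l n (kOf (coreOf os) i) (bnd (coreOf os) i) := by
  intro i
  induction i using Nat.strong_induction_on with
  | _ i IHi =>
    intro hi
    have IH : ∀ j < i, Cert l l n (kOf (coreOf os) j) (bnd (coreOf os) j) :=
      fun j hj => IHi j hj (lt_trans hj hi)
    have hc := hall i hi
    simp only [okXH, Bool.or_eq_true, decide_eq_true_eq] at hc
    rcases hc with hc | hc
    · rw [orbitCheckX, decide_eq_true_eq] at hc
      have hf := foldl_soundX os i IH (kOf (coreOf os) i) (os.getD i default).steps 0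
        (fun _ _ => Nat.zero_le _) (hob i hi)
      exact fun r β => hc.trans (hf r β)
    · have hyp : Cert l l n (kOf (coreOf os) i) (hypB hyps i) := by
        unfold hypB
        split
        · next e he =>
          have hmem := List.mem_of_find?_eq_some he
          have hi' : e.1 = i := by simpa using List.find?_some he
          rw [← hi']
          exact hh e hmem
        · exact fun _ _ => Nat.zero_le _
      exact cert_mono hc hyp

/-- `okXH` from the plain extended orbit check. -/
theorem okXH_of_orbitCheckX {os : List OrbitX} {hyps : List (ℕ × ℕ)} {i : ℕ}
    (h : orbitCheckX l n os i = true) : okXH l n os hyps i = true := by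
  simp [okXH, h]

/-- Reading off `Cert` at orbit `i` of a hypotheses-sweep, for any literal `K`, `b` equal to its fields. -/
theorem cert_of_sweepXH (os : List OrbitX) (hyps : List (ℕ × ℕ))
    (hall : ∀ i < os.length, okXH l n os hyps i = true)
    (hob : ∀ i < os.length, ObligsX l n os i)
    (hh : ∀ e ∈ hyps, Cert l l n (kOf (coreOf os) e.1) e.2)
    (i : ℕ) (hi : i < os.length) {K : List ℕ} {b : ℕ} (hK : kOf (coreOf os) i = K) (hb : b ≤ bnd (coreOf os) i) :
    Cert l l n K b := by
  have h := sweepXH os hyps hall hob hh i hi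
  rw [hK] at h
  exact cert_mono hb h

/-- An orbit with exactly ONE step passes its extended check, from the named Boolean facts about that step. -/
theorem orbitCheckX_of_one (os : List OrbitX) (i : ℕ) (st : StepX)
    (hst : (os.getD i default).steps = [st])
    (h1 : stepSideX l n os i (kOf (coreOf os) i) 0 st = true) (r1 : RootsOKX os st)
    (hb : bnd (coreOf os) i ≤ stepValX os st) : orbitCheckX l n os i = true := by
  apply orbitCheckX_of_chain os i
  · rw [hst]
    simp only [chainBX, h1, Bool.true_and, Nat.zero_max]
    exact decide_eq_true (by simpa using hb)
  · rw [hst]; exact ⟨r1, trivial⟩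

/-- **An LP orbit passes its check** from: the step equation, the candidate cover, the two lookup tables validated by
the FAST checks (`fastTableOK`, `fastTableTOK`), the LP-leaf test, and the claimed bound `≤ target`. -/
theorem ok_lp (os : List OrbitX) (i : ℕ) {cands : List ℕ} {target : ℕ} {table tableT : List LookRow}
    {rows : List (ℕ × ℕ)} {D : ℕ}
    (hst : (os.getD i default).steps = [StepX.lp cands target table tableT rows D])
    (hcov : coverB l l (kOf (coreOf os) i) cands = true)
    (htab : fastTableOK l l (coreOf os) i (kOf (coreOf os) i) cands table = true)
    (htabT : fastTableTOK l (coreOf os) i (kOf (coreOf os) i) cands tableT = true)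
    (hleaf : lpLeafMB (fun fm => lbOf2 (coreOf os) table tableT (setOf cands.length fm)) target rows D 0
      (Fin.elim0 : Fin 0 → Fin cands.length) = true)
    (hb : bnd (coreOf os) i ≤ target) : orbitCheckX l n os i = true := by
  refine orbitCheckX_of_one os i _ hst ?_ hleaf hb
  simp only [stepSideX, hcov, tableOK_of_fast htab, Bool.true_and]
  unfold tableTOK
  exact tableTOK_of_fast htabT

/-- Mask-leaf helper with an indirection table: rows `(u, y)` refer to the `u`-th mask of `uT` (data files keep one list of
distinct superspace masks per orbit). -/
def MLI (N : ℕ) (uT : List ℕ) (rs : List (ℕ × ℕ)) (D : ℕ) : MCert N := MCert.leaf (rs.map fun p => (uT.getD p.1 0, p.2)) D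

/-- Side conditions of an LP step from the candidate cover and the two FAST table checks. -/
theorem stepSideX_lp (os : List OrbitX) (i : ℕ) (K : List ℕ) (cur : ℕ) {cands : List ℕ} {target : ℕ}
    {table tableT : List LookRow} {rows : List (ℕ × ℕ)} {D : ℕ}
    (hcov : coverB l l K cands = true)
    (htab : fastTableOK l l (coreOf os) i K cands table = true)
    (htabT : fastTableTOK l (coreOf os) i K cands tableT = true) :
    stepSideX l n os i K cur (StepX.lp cands target table tableT rows D) = true := by
  have htT : tableTOK l (coreOf os) i K cands tableT = true := by
    unfold tableTOK; exact tableTOK_of_fast htabT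
  simp only [stepSideX, hcov, tableOK_of_fast htab, htT, Bool.and_self]

/-- Side conditions of an LP-DFS round from its parts (target ≤ running bound + 1, non-vanishing, cover, FAST tables). -/
theorem stepSideX_dfsLP (os : List OrbitX) (i : ℕ) (K : List ℕ) (cur : ℕ) {cands : List ℕ} {target x b c : ℕ}
    {table tableT : List LookRow} {roots : Fin cands.length → MCert cands.length}
    (ht : target ≤ cur + 1) (hnz : nzB l l n K x b c = true) (hcov : coverB l l K cands = true)
    (htab : fastTableOK l l (coreOf os) i K cands table = true)
    (htabT : fastTableTOK l (coreOf os) i K cands tableT = true) :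
    stepSideX l n os i K cur (StepX.dfsLP cands target x b c table tableT roots) = true := by
  have htT : tableTOK l (coreOf os) i K cands tableT = true := by
    unfold tableTOK; exact tableTOK_of_fast htabT
  simp only [stepSideX, hnz, hcov, tableOK_of_fast htab, htT, Bool.and_true, decide_eq_true_eq]
  exact ht

/-- An orbit with exactly TWO steps passes its extended check, from the named facts (running bound after the first
step is `cur = stepValX st1`). -/
theorem orbitCheckX_of_two (os : List OrbitX) (i : ℕ) (st1 st2 : StepX) (cur : ℕ)
    (hst : (os.getD i default).steps = [st1, st2])
    (h1 : stepSideX l n os i (kOf (coreOf os) i) 0 st1 = true) (r1 : RootsOKX os st1)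
    (hcur : max 0 (stepValX os st1) = cur)
    (h2 : stepSideX l n os i (kOf (coreOf os) i) cur st2 = true) (r2 : RootsOKX os st2)
    (hb : bnd (coreOf os) i ≤ max cur (stepValX os st2)) : orbitCheckX l n os i = true := by
  apply orbitCheckX_of_chain os i
  · rw [hst]
    simp only [chainBX, h1, Bool.true_and, hcur, h2]
    exact decide_eq_true hb
  · rw [hst]; exact ⟨r1, r2, trivial⟩

/-- `RootsOKX` of an LP step is its LP-leaf test. -/
theorem rootsOKX_lp (os : List OrbitX) {cands : List ℕ} {target : ℕ} {table tableT : List LookRow}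
    {rows : List (ℕ × ℕ)} {D : ℕ}
    (h : lpLeafMB (fun fm => lbOf2 (coreOf os) table tableT (setOf cands.length fm)) target rows D 0
      (Fin.elim0 : Fin 0 → Fin cands.length) = true) :
    RootsOKX os (StepX.lp cands target table tableT rows D) := h

end Summit.Ventures.MM22.GF2Cert
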